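import Mathlib
import Summits.Ventures.PercRepro2.Defs
import Summits.Ventures.PercRepro2.Graph
import Summits.Ventures.PercRepro2.Harris
import Summits.Ventures.PercRepro2.Events
import Summits.Ventures.PercRepro2.Induced
import Summits.Ventures.PercRepro2.VdBKahn
import Summits.Ventures.PercRepro2.GateDefs
import Summits.Ventures.PercRepro2.GateFrame
import Summits.Ventures.PercRepro2.GateShift
import Summits.Ventures.PercRepro2.GateAnatomy

/-!
# The free one-sided gate when the hull-containment event is a cylinder (blind cell PercRepro2,
mine-c g8; MINE-C.md §15, proofs/MINEC-LSMGATE.md §7)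

Class `B = {w ∈ C(t)} ∩ {s ↮ t, s ↮ u}` of the free gate (`GateAnatomy.classB`). Suppose that, on
`R′ = {s ↮ t, s ↮ u}`, the event `{w ∈ C(t)}` is the CYLINDER `{all edges of P open}` for a fixed
edge set `P` — as it is on every forest (`P` = the unique `t–w` path), and whenever `w` hangs on
`t` by a pendant path. Forcing the edges of `P` open turns the product law `p` into the product
law `forceOpen p P` (`p′_e = 1` on `P`), and `P_p(A ∩ {P open}) = (∏_{e ∈ P} p_e) · P_{p′}(A)`
(`prob_inter_cylinder`). Hence `covB` is `(∏_P p_e)²` times the van den Berg–Kahn covariance of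
the markers given `R′` under `p′`, which is `≥ 0` (`vdBK`): `covC_classB_nonneg_of_cylinder`.
With `covA ≥ 0` (`Gate.hull_frame_pa`) and `GateAnatomy.gateRow_of_within` this proves the free
gate unconditionally in the cylinder case: **`gateRow_of_cylinder`**. (Companion of `GateLSM.lean`,
the FKG-lattice mechanism for triangular cacti; the two files are independent.)
-/

namespace Summit.Ventures.PercRepro2

namespace GateCylinder

variable {V : Type*} {E : Type*} [Fintype E] [DecidableEq E] [Fintype V] [DecidableEq V]
  {R : Type*} [Field R] [LinearOrder R] [IsStrictOrderedRing R]

/-- The cylinder event `{ω | every edge of P is open}`. -/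
def cylinder (P : Finset E) : Set (Config E) := {ω | ∀ e ∈ P, ω e = true}

/-- The weights with the edges of `P` forced open. -/
def forceOpen (p : E → R) (P : Finset E) : E → R := fun e => if e ∈ P then 1 else p e

omit [Fintype E] [Fintype V] [DecidableEq V] [LinearOrder R] [IsStrictOrderedRing R] in
/-- `forceOpen` agrees with `p` off `P`. -/
lemma forceOpen_of_notMem (p : E → R) (P : Finset E) {e : E} (he : e ∉ P) :
    forceOpen p P e = p e := by
  simp [forceOpen, he]

omit [Fintype E] [Fintype V] [DecidableEq V] [LinearOrder R] [IsStrictOrderedRing R] in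
/-- `forceOpen` is `1` on `P`. -/
lemma forceOpen_of_mem (p : E → R) (P : Finset E) {e : E} (he : e ∈ P) :
    forceOpen p P e = 1 := by
  simp [forceOpen, he]

omit [Fintype E] [Fintype V] [DecidableEq V] in
/-- Forcing edges open keeps the weights admissible. -/
lemma isProbVec_forceOpen {p : E → R} (hp : IsProbVec p) (P : Finset E) :
    IsProbVec (forceOpen p P) := by
  refine ⟨fun e => ?_, fun e => ?_⟩
  · by_cases he : e ∈ P
    · rw [forceOpen_of_mem p P he]; exact zero_le_one
    · rw [forceOpen_of_notMem p P he]; exact hp.nonneg e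
  · by_cases he : e ∈ P
    · rw [forceOpen_of_mem p P he]
    · rw [forceOpen_of_notMem p P he]; exact hp.le_one e

omit [Fintype V] [DecidableEq V] [LinearOrder R] [IsStrictOrderedRing R] in
/-- The weight of a configuration in the cylinder: `weight p ω = (∏_{e ∈ P} p_e) · weight p′ ω`. -/
lemma weight_of_mem_cylinder (p : E → R) (P : Finset E) {ω : Config E} (hω : ω ∈ cylinder P) :
    weight p ω = (∏ e ∈ P, p e) * weight (forceOpen p P) ω := by
  unfold weight
  rw [← Finset.prod_filter_mul_prod_filter_not Finset.univ (· ∈ P),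
    ← Finset.prod_filter_mul_prod_filter_not Finset.univ (· ∈ P)]
  have h1 : ∏ e ∈ Finset.univ.filter (· ∈ P), edgeFactor (p e) (ω e) = ∏ e ∈ P, p e := by
    rw [Finset.filter_mem_eq_inter, Finset.univ_inter]
    refine Finset.prod_congr rfl fun e he => ?_
    simp [hω e he, edgeFactor]
  have h2 : ∏ e ∈ Finset.univ.filter (· ∈ P), edgeFactor (forceOpen p P e) (ω e) = 1 := by
    rw [Finset.filter_mem_eq_inter, Finset.univ_inter]
    refine Finset.prod_eq_one fun e he => ?_
    simp [hω e he, forceOpen, he, edgeFactor]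
  have h3 : ∏ e ∈ Finset.univ.filter (· ∉ P), edgeFactor (forceOpen p P e) (ω e) =
      ∏ e ∈ Finset.univ.filter (· ∉ P), edgeFactor (p e) (ω e) := by
    refine Finset.prod_congr rfl fun e he => ?_
    have he' : e ∉ P := (Finset.mem_filter.mp he).2
    simp [forceOpen, he']
  rw [h1, h2, h3, one_mul]

omit [Fintype V] [DecidableEq V] [LinearOrder R] [IsStrictOrderedRing R] in
/-- Off the cylinder the forced weight vanishes. -/
lemma weight_forceOpen_of_notMem_cylinder (p : E → R) (P : Finset E) {ω : Config E}
    (hω : ω ∉ cylinder P) : weight (forceOpen p P) ω = 0 := by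
  unfold weight
  simp only [cylinder, Set.mem_setOf_eq, not_forall] at hω
  obtain ⟨e, he, hne⟩ := hω
  refine Finset.prod_eq_zero (Finset.mem_univ e) ?_
  have hf : ω e = false := by
    cases h : ω e
    · rfl
    · exact absurd h hne
  rw [hf]
  simp [forceOpen, he, edgeFactor]

omit [Fintype V] [DecidableEq V] [LinearOrder R] [IsStrictOrderedRing R] in
/-- **Forced edges**: `P_p(A ∩ {P open}) = (∏_{e ∈ P} p_e) · P_{p′}(A)`. -/
theorem prob_inter_cylinder (p : E → R) (P : Finset E) (A : Set (Config E)) :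
    prob p (A ∩ cylinder P) = (∏ e ∈ P, p e) * prob (forceOpen p P) A := by
  unfold prob
  rw [Finset.mul_sum]
  refine Finset.sum_congr rfl fun ω _ => ?_
  by_cases hω : ω ∈ cylinder P
  · by_cases hA : ω ∈ A
    · rw [Set.indicator_of_mem (Set.mem_inter hA hω), Set.indicator_of_mem hA,
        weight_of_mem_cylinder p P hω]
    · rw [Set.indicator_of_notMem (fun h => hA h.1), Set.indicator_of_notMem hA, mul_zero]
  · rw [Set.indicator_of_notMem (fun h => hω h.2)]
    by_cases hA : ω ∈ A
    · rw [Set.indicator_of_mem hA, weight_forceOpen_of_notMem_cylinder p P hω, mul_zero]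
    · rw [Set.indicator_of_notMem hA, mul_zero]

variable (p : E → R) (ends : E → Sym2 V) (s t a b u w : V)

/-- **Class B is positively associated when its hull-containment event is a cylinder**:
if `B = {P open} ∩ R′`, then `covB = (∏_P p_e)² · [P′(R′) P′(XY; R′) − P′(X; R′) P′(Y; R′)] ≥ 0`
by van den Berg–Kahn under the forced weights. -/
theorem covC_classB_nonneg_of_cylinder (hp : IsProbVec p) (P : Finset E)
    (hB : GateAnatomy.classB ends s t u w = cylinder P ∩ avoidAll ends s ({t} ∪ {u})) :
    0 ≤ GateAnatomy.covC p ends s a b (GateAnatomy.classB ends s t u w) := by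
  unfold GateAnatomy.covC
  rw [hB]
  have e0 : cylinder P ∩ avoidAll ends s ({t} ∪ {u}) =
      avoidAll ends s ({t} ∪ {u}) ∩ cylinder P := Set.inter_comm _ _
  have e1 : ∀ X : Finset V, connAll ends s X ∩ (cylinder P ∩ avoidAll ends s ({t} ∪ {u})) =
      (connAll ends s X ∩ avoidAll ends s ({t} ∪ {u})) ∩ cylinder P := by
    intro X; ext ω; simp only [Set.mem_inter_iff]; tauto
  rw [e1 ({a} ∪ {b}), e1 {a}, e1 {b}, e0, prob_inter_cylinder, prob_inter_cylinder,
    prob_inter_cylinder, prob_inter_cylinder]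
  have hc : 0 ≤ ∏ e ∈ P, p e := Finset.prod_nonneg fun e _ => hp.nonneg e
  have key := vdBK (forceOpen p P) (isProbVec_forceOpen hp P) ends s {a} {b} ({t} ∪ {u})
    ({t} ∪ {u})
  rw [Finset.inter_self, Finset.union_self] at key
  have hc2 : 0 ≤ (∏ e ∈ P, p e) * (∏ e ∈ P, p e) := mul_nonneg hc hc
  nlinarith [mul_le_mul_of_nonneg_left key hc2]

/-- **The free one-sided gate in the cylinder case** (unconditional): if on `R′ = {s ↮ t, s ↮ u}`
the event `{w ∈ C(t)}` is `{all edges of P open}` and both classes have positive mass, then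
`Gate.GateRow s {t} a b {u} {w}`. Instances: every forest (`P` = the `t–w` path); `w` joined to
`t` by a pendant path. -/
theorem gateRow_of_cylinder (hp : IsProbVec p) (P : Finset E)
    (hB : GateAnatomy.classB ends s t u w = cylinder P ∩ avoidAll ends s ({t} ∪ {u}))
    (hA : 0 < prob p (GateAnatomy.classA ends s t w))
    (hBpos : 0 < prob p (GateAnatomy.classB ends s t u w)) :
    Gate.GateRow p ends s {t} a b {u} {w} := by
  refine GateAnatomy.gateRow_of_within p ends s t a b u w hp hA hBpos ?_
  have hAeq : GateAnatomy.classA ends s t w =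
      avoidAll ends s {t} ∩ (Gate.hitsK ends {t} {w})ᶜ := by
    ext ω
    simp [GateAnatomy.classA, Gate.hitsK, clusterInEvent]
  have h1 : 0 ≤ GateAnatomy.covC p ends s a b (GateAnatomy.classA ends s t w) := by
    unfold GateAnatomy.covC
    rw [sub_nonneg, hAeq]
    have := Gate.hull_frame_pa p ends s {t} {w} a b hp
    linarith [this]
  have h2 := covC_classB_nonneg_of_cylinder p ends s t a b u w hp P hB
  have hpa := prob_nonneg hp (GateAnatomy.classA ends s t w)
  have hpb := prob_nonneg hp (GateAnatomy.classB ends s t u w)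
  nlinarith [mul_nonneg hpb h1, mul_nonneg hpa h2]

end GateCylinder

end Summit.Ventures.PercRepro2
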